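import Summits.Langlands.Langlands.Theses.FifteenLocusEisenstein
import Summits.Langlands.Langlands.Theorems.IrreducibilityBySelfDualityIrreducibleOffSectorLanglandsOfReciprocity
import Summits.Langlands.Langlands.Theorems.IrreducibilityBySelfDualityReciprocityUpToIrreducibilityIsobaricRigidity
import Summits.Langlands.Langlands.Theorems.IrreducibilityBySelfDualityReciprocityUpToIrreducibilityDeRhamBlocks
import Summits.Langlands.Langlands.Theorems.IrreducibilityBySelfDualityReciprocityUpToIrreducibilityGeometricConstituents
import Literature.NumberTheory.Automorphic.IsAutomorphicAE
import Literature.NumberTheory.Automorphic.GLnAdelicStructureProofs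
import HarnessLib

/-!
# Birth skeleton (BC3) for crux stmt-Langlands-16058
`Summit.Langlands.Langlands.Theses.FifteenLocusEisenstein.SectorComplement` — line `birth_FifteenLocusEisenstein`

File name. The crux directory `Cruxes/SectorComplement/` is SHARED by the homonymous cruxes of several routes
(`ledger crux dir` maps stmt-Langlands-12923 SkinnerWilesDefectOne, stmt-Langlands-14623 HolomorphicShadow,
stmt-Langlands-12840 MirrorPairReflection and stmt-Langlands-16058 FifteenLocusEisenstein to the same path).
`Lines/birth.lean` is 14623's registered skeleton; following the `birth_<Route>` convention already used by
12840 (`Lines/birth_MirrorPairReflection.lean`), this line is published as `Lines/birth_FifteenLocusEisenstein.lean`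
/ `.md`, namespace `Summit.Langlands.Langlands.Cruxes.SectorComplement.BirthFifteenLocusEisenstein`.

Route `route-Langlands-FifteenLocusEisenstein` (deciding theorem `closes : IrreducibleFiveModular →
NonOrdinaryEisensteinModular → UnorientedOrdinaryModular → ReducibleOrdinaryModular → OrientedOrdinaryOfEngine →
SectorComplement → Langlands`, rev 3).  The crux is the route's declared RESIDUAL (rank 9, difficulty open-problem):

  `SectorComplement := Target → _root_.Langlands`

(the Target text is INLINED verbatim in the route file; `sectorComplement_iff : SectorComplement ↔ (Target → Langlands)
:= Iff.rfl` below), where `Target` (item stmt-Langlands-16053) is MODULARITY OF EVERY NON-CM ELLIPTIC CURVE OVER EVERY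
IMAGINARY QUADRATIC FIELD in point-count form: for `F` totally complex with `[F:ℚ] = 2`, every integral Weierstrass
model `E/𝓞_F` with `Δ ≠ 0` and `¬ (E.baseChange F).HasCM`, and every level witness `hcpt`, an L-algebraic cuspidal `π`
on `GL₂(𝔸_F)` whose Satake parameters satisfy `Σ α⁻¹ = a_w(E)` (`frobTraceAt`) and `Π α⁻¹ = N w` at almost every `w`.
Grounder g50-2: NEW / open-problem by design, trivially implied by the summit (`fun h _ => h`).

## The skeleton: `Langlands` along the structural seam W / B_w / LGC / JS, with B_w cut along the TATE-FRAME sector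

The only typed decomposition of the summit the tree has certified (crux-strategist of the sibling junction
`CapacityClassicality.SectorToLanglands`, stmt-Langlands-10368, `Cruxes/SectorToLanglands/Lines/SectorToLanglandsOfLeaves.lean`,
rc 0, 0 sorry; the text form of the landed decoupling `ReciprocityUpToIrreducibility.reciprocityUpToIrreducibility_of_weak`,
p116715; re-used by the two sibling births `Lines/birth.lean` (14623) and `Lines/birth_MirrorPairReflection.lean` (12840)) is

  `W → B_w → LGC → JS (2.2) → JS (2.3) → Langlands`

(W = Buzzard–Gee Conj. 3.2.2 weak form: a pinned-geometric avatar, Satake–Frobenius compatible a.e.; B_w =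
Fontaine–Mazur–Langlands, a.e. form; LGC = Taylor 2004 Conj. 7 for irreducible pinned-geometric a.e.-compatible pairs, the
only clause carrying `∃ Rec`; JS = Arthur–Clozel Ch. 3 (2.2)/(2.3) for Borel–Jacquet data, the Literature named facts
`JacquetShalika1981_partialPairL_boundary_repData` / `…_pole_repData`).  Its seam is NOT trivial: direction (A) needs the
avatar of W to be IRREDUCIBLE, which is the isobaric bootstrap (geometric constituents + de Rham heredity + Jacquet–Shalika
rigidity, the landed `stub_geometricConstituents` p99702 / `stub_deRhamBlocks` p98936 / `stub_isobaricRigidity` p105601) run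
with B_w, then the landed structural theorem `IrreducibleOffSector.langlands_of_reciprocityUpToIrreducibility_text_of_JS`
(irreducibility of every avatar + Chebotarev–Brauer–Nesbitt uniqueness up to conjugacy).

THIS file makes the crux's hypothesis `Target` load-bearing by cutting B_w along the **Tate-frame sector** — exactly the
typed notion through which the route addresses `ρ_(E,p)` ("irreducible Tate frames", route header):

  `K` totally complex ∧ `[K:ℚ] = 2` ∧ `n = 2` ∧ `∃ E : WeierstrassCurve (𝓞 K)`, `E.Δ ≠ 0` ∧ `¬ (E.baseChange K).HasCM` ∧
  `∀ᶠ w in cofinite`, `ρ` unramified at `w` with `charpoly ρ(Frob_w) = X² − a_w(E) X + N w`.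

* `stub_weakExistence` — W (open beyond regular algebraic / Shin–HLTT–Scholze; verbatim the sibling child `WeakExistence`);
* `stub_weakAutomorphyOffTateFrames` — B_w OFF the Tate-frame sector (open: Fontaine–Mazur–Langlands for all `n`, all `K`,
  minus the weight-(0,1) elliptic slice over imaginary quadratic fields);
* `stub_tateFramesOfTarget` — `Target →` B_w ON the sector: **the stub that uses the crux's hypothesis**.  Content (size M,
  pure algebra, true in substance): `Target` at `(K, E, hcpt)` gives `π` with `Σ α⁻¹ = a_w`, `Π α⁻¹ = N w` a.e.; a Satake
  parameter of `GL₂` has two entries (`HasSatakeParamAt.card_eq`), so `arithFrobPolyOfSatake ι (N w) 1 α =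
  ∏ (X − ι⁻¹(α_j⁻¹)) = X² − ι⁻¹(Σ α⁻¹) X + ι⁻¹(Π α⁻¹) = X² − a_w X + N w` (`arithFrobPolyOfSatake_one`, Vieta for a 2-multiset,
  `ι⁻¹` fixes integer casts), which IS the frame's charpoly clause — the transport the banked `fiveIsogenyEllipticCurves_proof`
  and the route's crux `OrientedOrdinaryOfEngine` perform in the opposite direction;
* `stub_pairCompatibility` — LGC (open in general; verbatim the sibling child `PairCompatibility`);
* `stub_pairLBoundaryJS`, `stub_pairLPoleJS` — the two Jacquet–Shalika named facts BY NAME (known theorems, Literature T0 debts).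

`SectorComplement_of` (kernel-checked, no `sorry`; hypotheses = the six stub statements by name via `_Goal.stub_x :=
type_of% @stub_x`): rebuild B_w by a case split on the sector (`Target` discharges the sector through
`stub_tateFramesOfTarget`), then the sibling bootstrap verbatim.  `lean check`: sorries = the six stubs, nothing else.

Disproof used: none exists for this crux item (`ledger crux ls stmt-Langlands-16058` 2026-08-17: no `Disproof.lean`; no landed
Negative lemma under `Theorems/SectorComplement/`).  The homonymous HELD item stmt-Langlands-12923 (SkinnerWilesDefectOne)
shares the directory; its NOTES.md §3 (L3) analysis — "stubs ⊇ Langlands minus the sector" — is exactly the shape adopted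
here, with the sector typed and used.  dead_lines: none recorded.

References: K. Buzzard, T. Gee, LMS LNS 414 (2014), Conj. 3.2.1–3.2.2 [BuzzardGeeLMS2014]; J.-M. Fontaine, B. Mazur (1995),
Conj. 1 [FontaineMazurGeometric1995]; R. Taylor, Ann. Fac. Sci. Toulouse 13 (2004), Conj. 7–8 [TaylorGaloisRepresentations2004];
J. Arthur, L. Clozel, Ann. Math. Stud. 120, Ch. 3 §2 (2.2)–(2.3) [ArthurClozelAMS120]; H. Jacquet, J. Shalika, AJM 103 (1981)
[JacquetShalikaAJM1981, JacquetShalikaAJM1981II]; A. Caraiani, J. Newton (2023), Thm. 1.1 / 7.1 [CaraianiNewton2023];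
J. Silverman, AEC (2009), V.2 [SilvermanAEC2009]; F. Calegari, ICM 2022 survey §12 [Calegari2023].
-/

noncomputable section

set_option linter.dupNamespace false -- project-wide option; `Summit.Langlands.Langlands` is the mandated namespace

open scoped NumberField Classical Polynomial Topology
open Filter IsDedekindDomain Polynomial
open Literature.NumberTheory.Automorphic Literature.NumberTheory.GaloisRepresentations
open Summit.Langlands
open Summit.Langlands.Langlands.Theorems.ReciprocityUpToIrreducibility
open Summit.Langlands.Langlands.Theses.FifteenLocusEisenstein (SectorComplement Target)

namespace Summit.Langlands.Langlands.Cruxes.SectorComplement.BirthFifteenLocusEisenstein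

/-! ## 0. The crux's hypothesis, by name -/

/-- The crux IS `Target → Langlands`, definitionally (the route file inlines the Target text verbatim). [folklore] -/
theorem sectorComplement_iff : SectorComplement ↔ (Target → _root_.Langlands) :=
  Iff.rfl

/-! ## 1. The six stubs (the ONLY sorries of this file) -/

/-- **stub W — weak existence** (Buzzard–Gee Conj. 3.2.2, weak form; OPEN beyond regular algebraic `π` over CM / totally real
`K` — Harris–Lan–Taylor–Thorne 2016 Thm A + Scholze 2015 V.4.2 give the avatar there, de Rham by A'Campo 2024 / Caraiani–Newton in
the crystalline range; nothing for irregular `π` (NonRegularWeightBarrier) or for `K` neither CM nor totally real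
(ShimuraVarietyRealizationBarrier)): every L-algebraic cuspidal `π` of `GL_n(𝔸_K)` has, for all `ℓ, ι`, SOME
`ρ : Γ_K → GL_n(ℚ̄_ℓ)` unramified a.e., de Rham above `ℓ` for Fontaine's pinned datum, and Satake–Frobenius compatible with `π`
a.e.  Verbatim the text of the sibling child `CapacityClassicality.WeakExistence`.
[cite: BuzzardGeeLMS2014, Conj. 3.2.2] [cite: FontaineMazurGeometric1995, §1] -/
theorem stub_weakExistence : ∀ (K : Type) [Field K] [NumberField K] (n : ℕ) (hcpt : Literature.NumberTheory.Automorphic.isCompact_glFiniteIntegralLevel n K), 0 < n → ∀ π : Literature.NumberTheory.Automorphic.CuspidalAutomorphicRepData n K hcpt, π.1.IsLAlgebraic → ∀ (ℓ : ℕ) [Fact ℓ.Prime] (ι : PadicAlgCl ℓ ≃+* ℂ), ∃ ρ : Literature.NumberTheory.GaloisRepresentations.FramedGaloisRep K (PadicAlgCl ℓ) n, ((∀ᶠ v : IsDedekindDomain.HeightOneSpectrum (NumberField.RingOfIntegers K) in cofinite, ρ.IsUnramifiedAt v) ∧ ∀ (v : IsDedekindDomain.HeightOneSpectrum (NumberField.RingOfIntegers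 K)) (hv : ((ℓ : ℕ) : NumberField.RingOfIntegers K) ∈ v.asIdeal), (Literature.NumberTheory.PAdicHodge.fontainePstAdicCompletion v ℓ hv).IsDeRhamFramed (ρ.toLocal v)) ∧ ∀ᶠ v : IsDedekindDomain.HeightOneSpectrum (NumberField.RingOfIntegers K) in cofinite, SatakeFrobCompatibleAt ι π.1 ρ v := by
  sorry

/-- **stub B_w⁻ — weak automorphy OFF the Tate-frame sector** (Fontaine–Mazur 1995 Conj. 1 + Langlands, a.e. form, for every
`n ≥ 1` and every number field `K`, EXCEPT the sector `K` totally complex ∧ `[K:ℚ] = 2` ∧ `n = 2` ∧ `ρ` an a.e. Tate frame of a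
non-CM integral Weierstrass model `E/𝓞_K` (`charpoly ρ(Frob_w) = X² − a_w(E) X + N w` a.e.); OPEN — known for odd Artin `GL₂/ℚ`
(Khare–Wintenberger 2009), regular Hodge–Tate weights under the automorphy-lifting provisos (BLGGT 2014, ACC+ 2023), abelian
surfaces (BCGP), open for irregular weights, `n ≥ 3` non-self-dual, general `K`): every irreducible `ρ : Γ_K → GL_n(ℚ̄_ℓ)`
unramified a.e. and de Rham above `ℓ` (pinned datum), NOT in the sector, has an L-algebraic cuspidal `π` Satake–Frobenius
compatible a.e.  Why it might fail: it is (B) of the summit minus one slice.  [cite: FontaineMazurGeometric1995, Conj. 1]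
[cite: BuzzardGeeLMS2014, Conj. 3.2.2] [cite: KhareWintenberger2009, Thm. 1.2] [cite: BarnetlambEtAl2014, Thm. A] -/
theorem stub_weakAutomorphyOffTateFrames : ∀ (K : Type) [Field K] [NumberField K] (n : ℕ) (hcpt : Literature.NumberTheory.Automorphic.isCompact_glFiniteIntegralLevel n K), 0 < n → ∀ (ℓ : ℕ) [Fact ℓ.Prime] (ι : PadicAlgCl ℓ ≃+* ℂ) (ρ : Literature.NumberTheory.GaloisRepresentations.FramedGaloisRep K (PadicAlgCl ℓ) n), ρ.toGaloisRep.IsIrreducible → ((∀ᶠ v : IsDedekindDomain.HeightOneSpectrum (NumberField.RingOfIntegers K) in cofinite, ρ.IsUnramifiedAt v) ∧ ∀ (v : IsDedekindDomain.HeightOneSpectrum (NumberField.RingOfIntegers K)) (hv : ((ℓ : ℕ) : NumberField.RingOfIntegers K) ∈ v.asIdeal), (Literature.NumberTheory.PAdicHodge.fontainePstAdicCompletion v ℓ hv).IsDeRhamFramed (ρ.toLocal v)) → ¬ (NumberField.IsTotallyComplex K ∧ Module.finrank ℚ K = 2 ∧ n = 2 ∧ ∃ E : WeierstrassCurve (NumberField.RingOfIntegers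 K), E.Δ ≠ 0 ∧ ¬ (E.baseChange K).HasCM ∧ ∀ᶠ w : IsDedekindDomain.HeightOneSpectrum (NumberField.RingOfIntegers K) in cofinite, ρ.IsUnramifiedAt w ∧ ρ.HasFrobCharpolyAt w (Polynomial.X ^ 2 - Polynomial.C ((Literature.NumberTheory.Automorphic.frobTraceAt E w : ℤ) : PadicAlgCl ℓ) * Polynomial.X + Polynomial.C ((w.residueCard : ℕ) : PadicAlgCl ℓ))) → ∃ π : Literature.NumberTheory.Automorphic.CuspidalAutomorphicRepData n K hcpt, π.1.IsLAlgebraic ∧ ∀ᶠ v : IsDedekindDomain.HeightOneSpectrum (NumberField.RingOfIntegers K) in cofinite, SatakeFrobCompatibleAt ι π.1 ρ v := by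
  sorry

/-- **stub B_w⁺ — the Tate-frame sector from `Target`** (THE STUB THAT USES the crux's hypothesis; true in substance, size M):
granted `Target` (modularity of every non-CM `E/𝓞_K`, `K` imaginary quadratic, in point-count form: `Σ α⁻¹ = a_w(E)`,
`Π α⁻¹ = N w` a.e.), every irreducible `ρ : Γ_K → GL₂(ℚ̄_ℓ)` which is an a.e. Tate frame of such an `E` (`ρ` unramified at `w`
with `charpoly ρ(Frob_w) = X² − a_w(E) X + N w` for almost every `w`) has an L-algebraic cuspidal `π` on `GL₂(𝔸_K)` with
`SatakeFrobCompatibleAt ι π.1 ρ w` a.e. (roots `ι⁻¹(α_j⁻¹)` of the arithmetic Frobenius).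
Proof plan: `Target` at `(K, E, hcpt)` gives `π`, L-algebraic, with Satake parameter `α_w`, `Σ α⁻¹ = a_w`, `Π α⁻¹ = N w` on a
cofinite set; intersect with the frame's cofinite set; `card α_w = 2` (`HasSatakeParamAt.card_eq`), so by `arithFrobPolyOfSatake_one`
and Vieta for a two-element multiset `arithFrobPolyOfSatake ι (N w) 1 α_w = X² − C (ι⁻¹ (Σ α⁻¹)) X + C (ι⁻¹ (Π α⁻¹)) =
X² − C (a_w : ℚ̄_ℓ) X + C (N w : ℚ̄_ℓ)` (`ι⁻¹` is a ring isomorphism, fixing the casts of `a_w ∈ ℤ`, `N w ∈ ℕ`), which is the frame's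
charpoly clause verbatim.  Why it might fail: only through a normalisation slip (`Σ α⁻¹` vs `Σ α`, i.e. L- vs C-side), repairable
inside the proof — the convention is the one of the PROVED `fiveIsogenyEllipticCurves_proof`, which runs this transport backwards.
[cite: BuzzardGeeLMS2014, §2.1 and Conj. 3.2.2] [cite: CaraianiNewton2023, Thm. 1.1] [cite: SilvermanAEC2009, V.2.3.1] -/
theorem stub_tateFramesOfTarget : Target → ∀ (K : Type) [Field K] [NumberField K], NumberField.IsTotallyComplex K → Module.finrank ℚ K = 2 → ∀ (hcpt : Literature.NumberTheory.Automorphic.isCompact_glFiniteIntegralLevel 2 K) (ℓ : ℕ) [Fact ℓ.Prime] (ι : PadicAlgCl ℓ ≃+* ℂ) (ρ : Literature.NumberTheory.GaloisRepresentations.FramedGaloisRep K (PadicAlgCl ℓ) 2), ρ.toGaloisRep.IsIrreducible → ∀ (E : WeierstrassCurve (NumberField.RingOfIntegers K)), E.Δ ≠ 0 → ¬ (E.baseChange K).HasCM → (∀ᶠ w : IsDedekindDomain.HeightOneSpectrum (NumberField.RingOfIntegers K) in cofinite, ρ.IsUnramifiedAt w ∧ ρ.HasFrobCharpolyAt w (Polynomial.X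 ^ 2 - Polynomial.C ((Literature.NumberTheory.Automorphic.frobTraceAt E w : ℤ) : PadicAlgCl ℓ) * Polynomial.X + Polynomial.C ((w.residueCard : ℕ) : PadicAlgCl ℓ))) → ∃ π : Literature.NumberTheory.Automorphic.CuspidalAutomorphicRepData 2 K hcpt, π.1.IsLAlgebraic ∧ ∀ᶠ w : IsDedekindDomain.HeightOneSpectrum (NumberField.RingOfIntegers K) in cofinite, SatakeFrobCompatibleAt ι π.1 ρ w := by
  sorry

/-- **stub LGC — local–global compatibility for compatible pairs** (Taylor 2004 Conj. 7 at EVERY finite place, through the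
Grothendieck–Deligne recipe at `v ∤ ℓ` and Fontaine's pinned `D_pst` at `v ∣ ℓ`, for ONE reciprocity datum `Rec` per field —
the only clause carrying `∃ Rec`; OPEN in general: known for regular algebraic conjugate self-dual `π` over CM fields
(Harris–Taylor, Taylor–Yoshida, Caraiani) and `ℓ ≠ p` beyond (Varma), open for irregular `π` and at `v ∣ ℓ` in general; includes
the Harris–Taylor debt `LocalLanglandsDatum` of `Rec` itself): verbatim the text of the sibling child `CapacityClassicality.PairCompatibility`.
Why it might fail: a.e.-compatible irreducible pairs with a local mismatch at a ramified place would refute it (none known).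
[cite: TaylorGaloisRepresentations2004, Conj. 7] [cite: HarrisTaylorAMS2001, Thm. A] -/
theorem stub_pairCompatibility : ∀ (K : Type) [Field K] [NumberField K], ∃ Rec : ReciprocityData K, ∀ (n : ℕ) (hcpt : Literature.NumberTheory.Automorphic.isCompact_glFiniteIntegralLevel n K), 0 < n → ∀ (π : Literature.NumberTheory.Automorphic.CuspidalAutomorphicRepData n K hcpt), π.1.IsLAlgebraic → ∀ (ℓ : ℕ) [Fact ℓ.Prime] (ι : PadicAlgCl ℓ ≃+* ℂ) (ρ : Literature.NumberTheory.GaloisRepresentations.FramedGaloisRep K (PadicAlgCl ℓ) n), ρ.toGaloisRep.IsIrreducible → ((∀ᶠ v : IsDedekindDomain.HeightOneSpectrum (NumberField.RingOfIntegers K) in cofinite, ρ.IsUnramifiedAt v) ∧ ∀ (v : IsDedekindDomain.HeightOneSpectrum (NumberField.RingOfIntegers K)) (hv : ((ℓ : ℕ) : NumberField.RingOfIntegers K) ∈ v.asIdeal), (Literature.NumberTheory.PAdicHodge.fontainePstAdicCompletion v ℓ hv).IsDeRhamFramed (ρ.toLocal v)) → (∀ᶠ v : IsDedekindDomain.HeightOneSpectrum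 (NumberField.RingOfIntegers K) in cofinite, SatakeFrobCompatibleAt ι π.1 ρ v) → ∀ v : IsDedekindDomain.HeightOneSpectrum (NumberField.RingOfIntegers K), LocalGlobalCompatibleAt Rec ι π.1 ρ v := by
  sorry

/-- **stub JS (2.2)** — Jacquet–Shalika / Arthur–Clozel Ch. 3 (2.2) for Borel–Jacquet data, the Literature named fact BY NAME
(a THEOREM of the literature, a T0 debt of the tree hanging on its four `L²` leaves,
`JacquetShalika1981_partialPairL_boundary_repData_of_L2_leaves`; = item stmt-Langlands-13622 `IrreducibilityBySelfDuality.PairLBoundaryJS`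
definitionally).  [cite: ArthurClozelAMS120, Ch. 3 §2 (2.2)] [cite: JacquetShalikaAJM1981II, Prop. 3.6 and Thm. 4.4] -/
theorem stub_pairLBoundaryJS : Literature.NumberTheory.Automorphic.JacquetShalika1981_partialPairL_boundary_repData := by
  sorry

/-- **stub JS (2.3)** — Jacquet–Shalika / Arthur–Clozel Ch. 3 (2.3) for Borel–Jacquet data, the Literature named fact BY NAME
(a THEOREM of the literature; T0 debt hanging on the single `L²` leaf `JacquetShalika1981_partialPairL_pole_of_eq_conj`,
`JacquetShalika1981_partialPairL_pole_repData_of_pole_of_eq_conj`; rank one is already the theorem `…_pole_repData_one`).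
[cite: ArthurClozelAMS120, Ch. 3 §2 (2.3)] [cite: JacquetShalikaAJM1981II, Prop. 3.6] -/
theorem stub_pairLPoleJS : Literature.NumberTheory.Automorphic.JacquetShalika1981_partialPairL_pole_repData := by
  sorry

/-! ## 2. The stub statements as named propositions (hypotheses of the composition, admissible by stub name)

Each `_Goal.stub_x` is `type_of% @stub_x`: literally the stub's statement, no text duplicated, no `sorry` inherited. -/

namespace _Goal

/-- The statement of `stub_weakExistence` (literally its type). [folklore] -/
def stub_weakExistence : Prop :=
  type_of% @Summit.Langlands.Langlands.Cruxes.SectorComplement.BirthFifteenLocusEisenstein.stub_weakExistence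

/-- The statement of `stub_weakAutomorphyOffTateFrames` (literally its type). [folklore] -/
def stub_weakAutomorphyOffTateFrames : Prop :=
  type_of% @Summit.Langlands.Langlands.Cruxes.SectorComplement.BirthFifteenLocusEisenstein.stub_weakAutomorphyOffTateFrames

/-- The statement of `stub_tateFramesOfTarget` (literally its type). [folklore] -/
def stub_tateFramesOfTarget : Prop :=
  type_of% @Summit.Langlands.Langlands.Cruxes.SectorComplement.BirthFifteenLocusEisenstein.stub_tateFramesOfTarget

/-- The statement of `stub_pairCompatibility` (literally its type). [folklore] -/
def stub_pairCompatibility : Prop :=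
  type_of% @Summit.Langlands.Langlands.Cruxes.SectorComplement.BirthFifteenLocusEisenstein.stub_pairCompatibility

/-- The statement of `stub_pairLBoundaryJS` (literally its type). [folklore] -/
def stub_pairLBoundaryJS : Prop :=
  type_of% @Summit.Langlands.Langlands.Cruxes.SectorComplement.BirthFifteenLocusEisenstein.stub_pairLBoundaryJS

/-- The statement of `stub_pairLPoleJS` (literally its type). [folklore] -/
def stub_pairLPoleJS : Prop :=
  type_of% @Summit.Langlands.Langlands.Cruxes.SectorComplement.BirthFifteenLocusEisenstein.stub_pairLPoleJS

end _Goal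

/-! ## 3. The composition (kernel-checked, no `sorry`): W → B_w⁻ → (Target → B_w⁺) → LGC → JS (2.2) → JS (2.3) → SectorComplement -/

/-- **`SectorComplement` from its six stubs.**  Given `Target` (the crux's antecedent), B_w is rebuilt from its two halves by a
case split on the Tate-frame sector (`Target` discharges the sector through `stub_tateFramesOfTarget`); then, verbatim, the
sibling's isobaric bootstrap (irreducibility of W's avatar: geometric constituents + de Rham heredity, B_w on the constituents,
Jacquet–Shalika rigidity), the packaging of reciprocity-up-to-irreducibility for the `Rec` of LGC, and the landed structural
`IrreducibleOffSector.langlands_of_reciprocityUpToIrreducibility_text_of_JS`.  Hypotheses = the six stub statements by name;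
conclusion = the route decl by name.  [cite: BuzzardGeeLMS2014, Conj. 3.2.1 and Conj. 3.2.2]
[cite: ArthurClozelAMS120, Ch. 3 §2 (2.2)–(2.3)] [cite: CalegariGee2013, §1.1] [cite: DeligneSerreASENS1974, Lemme 3.2] -/
theorem SectorComplement_of (hW : _Goal.stub_weakExistence) (hOff : _Goal.stub_weakAutomorphyOffTateFrames)
    (hOn : _Goal.stub_tateFramesOfTarget) (hL : _Goal.stub_pairCompatibility)
    (hJSb : _Goal.stub_pairLBoundaryJS) (hJSp : _Goal.stub_pairLPoleJS) : SectorComplement := by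
  rw [sectorComplement_iff]
  intro hH
  dsimp only [_Goal.stub_weakExistence, _Goal.stub_weakAutomorphyOffTateFrames, _Goal.stub_tateFramesOfTarget,
    _Goal.stub_pairCompatibility, _Goal.stub_pairLBoundaryJS, _Goal.stub_pairLPoleJS] at hW hOff hOn hL hJSb hJSp
  -- B_w (Fontaine–Mazur–Langlands, a.e. form) from its two halves: the Tate-frame sector is discharged by Target
  have hB : ∀ (K : Type) [Field K] [NumberField K] (n : ℕ) (hcpt : Literature.NumberTheory.Automorphic.isCompact_glFiniteIntegralLevel n K), 0 < n → ∀ (ℓ : ℕ) [Fact ℓ.Prime] (ι : PadicAlgCl ℓ ≃+* ℂ) (ρ : Literature.NumberTheory.GaloisRepresentations.FramedGaloisRep K (PadicAlgCl ℓ) n), ρ.toGaloisRep.IsIrreducible → ((∀ᶠ v : IsDedekindDomain.HeightOneSpectrum (NumberField.RingOfIntegers K) in cofinite, ρ.IsUnramifiedAt v) ∧ ∀ (v : IsDedekindDomain.HeightOneSpectrum (NumberField.RingOfIntegers K)) (hv : ((ℓ : ℕ) : NumberField.RingOfIntegers K) ∈ v.asIdeal), (Literature.NumberTheory.PAdicHodge.fontainePstAdicCompletion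 v ℓ hv).IsDeRhamFramed (ρ.toLocal v)) → ∃ π : Literature.NumberTheory.Automorphic.CuspidalAutomorphicRepData n K hcpt, π.1.IsLAlgebraic ∧ ∀ᶠ v : IsDedekindDomain.HeightOneSpectrum (NumberField.RingOfIntegers K) in cofinite, SatakeFrobCompatibleAt ι π.1 ρ v := by
    intro K _ _ n hcpt hn ℓ _ ι ρ hirr hgeo
    by_cases hs : (NumberField.IsTotallyComplex K ∧ Module.finrank ℚ K = 2 ∧ n = 2 ∧ ∃ E : WeierstrassCurve (NumberField.RingOfIntegers K), E.Δ ≠ 0 ∧ ¬ (E.baseChange K).HasCM ∧ ∀ᶠ w : IsDedekindDomain.HeightOneSpectrum (NumberField.RingOfIntegers K) in cofinite, ρ.IsUnramifiedAt w ∧ ρ.HasFrobCharpolyAt w (Polynomial.X ^ 2 - Polynomial.C ((Literature.NumberTheory.Automorphic.frobTraceAt E w : ℤ) : PadicAlgCl ℓ) * Polynomial.X + Polynomial.C ((w.residueCard : ℕ) : PadicAlgCl ℓ)))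
    · obtain ⟨htc, hK, hn2, E, hΔ, hcm, hfr⟩ := hs
      subst hn2
      exact hOn hH K htc hK hcpt ℓ ι ρ hirr E hΔ hcm hfr
    · exact hOff K n hcpt hn ℓ ι ρ hirr hgeo hs
  -- the isobaric bootstrap, run with B_w: a pinned-geometric avatar of a cuspidal `π` is irreducible
  have irr : ∀ (K : Type) [Field K] [NumberField K] (n : ℕ) (hcpt : isCompact_glFiniteIntegralLevel n K)
      (_ : 0 < n) (π : CuspidalAutomorphicRepData n K hcpt) (ℓ : ℕ) [Fact ℓ.Prime]
      (ι : PadicAlgCl ℓ ≃+* ℂ) (ρ : FramedGaloisRep K (PadicAlgCl ℓ) n),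
      ((∀ᶠ v : HeightOneSpectrum (𝓞 K) in cofinite, ρ.IsUnramifiedAt v) ∧
        ∀ (v : HeightOneSpectrum (𝓞 K)) (hv : ((ℓ : ℕ) : 𝓞 K) ∈ v.asIdeal),
          (Literature.NumberTheory.PAdicHodge.fontainePstAdicCompletion v ℓ hv).IsDeRhamFramed
            (ρ.toLocal v)) →
      (∀ᶠ v : HeightOneSpectrum (𝓞 K) in cofinite, SatakeFrobCompatibleAt ι π.1 ρ v) →
        ρ.toGaloisRep.IsIrreducible := by
    intro K _ _ n hcpt hn π ℓ _ ι ρ hgeo hρ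
    obtain ⟨k, m, r, hr, hchar, -, hone⟩ :=
      stub_geometricConstituents stub_deRhamBlocks K ℓ n ρ hn hgeo
    by_cases hk1 : k = 1
    · exact hone hk1
    have hk0 : k ≠ 0 := by
      rintro rfl
      have h1 := hchar 1
      simp only [Finset.univ_eq_empty, Finset.prod_empty] at h1
      have hdeg : (FramedRep.charpoly ρ 1).natDegree = n := by
        simp [FramedRep.charpoly, Matrix.charpoly_natDegree_eq_dim]
      rw [h1, natDegree_one] at hdeg
      omega
    have hk2 : 2 ≤ k := by omega
    have hσ : ∀ i, ∃ σ : CuspidalAutomorphicRepData (m i) K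
        (isCompact_glFiniteIntegralLevel_holds (m i) K),
        ∀ᶠ v : HeightOneSpectrum (𝓞 K) in cofinite, SatakeFrobCompatibleAt ι σ.1 (r i) v := by
      intro i
      obtain ⟨σ, -, hcorr⟩ := hB K (m i) (isCompact_glFiniteIntegralLevel_holds (m i) K) (hr i).1 ℓ ι
        (r i) (hr i).2.1 (hr i).2.2
      exact ⟨σ, hcorr⟩
    choose σ hσc using hσ
    refine (stub_isobaricRigidity hJSb hJSp K n hcpt π k m
      (fun i => isCompact_glFiniteIntegralLevel_holds (m i) K) σ hn hk2 (fun i => (hr i).1) ?_).elim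
    have hall : ∀ᶠ v : HeightOneSpectrum (𝓞 K) in cofinite,
        ∀ i, SatakeFrobCompatibleAt ι (σ i).1 (r i) v :=
      Filter.eventually_all.mpr hσc
    filter_upwards [hρ, hall] with v hv hvi
    intro α hα
    obtain ⟨α₀, hα₀, -, hcp⟩ := hv
    obtain rfl : α = α₀ := AutomorphicRepData.hasSatakeParamAt_unique_holds π.1 hα hα₀
    choose β hβ _hurβ hcpβ using hvi
    refine ⟨β, hβ, ?_⟩
    have hprod : ρ.HasFrobCharpolyAt v (∏ i, arithFrobPolyOfSatake ι v.residueCard 1 (β i)) := by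
      intro 𝔓 h𝔓 τ hτ
      rw [hchar τ]
      exact Finset.prod_congr rfl fun i _ => hcpβ i 𝔓 h𝔓 τ hτ
    rw [← Summit.Langlands.Langlands.Theorems.IrreducibleOffSector.arithFrobPolyOfSatake_sum] at hprod
    have heq : arithFrobPolyOfSatake ι v.residueCard 1 α =
        arithFrobPolyOfSatake ι v.residueCard 1 (∑ i, β i) :=
      GaloisRep.HasFrobCharpolyAt.unique_holds
        ((FramedGaloisRep.hasFrobCharpolyAt_toGaloisRep_iff v _ ρ).mpr hcp)
        ((FramedGaloisRep.hasFrobCharpolyAt_toGaloisRep_iff v _ ρ).mpr hprod)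
    exact arithFrobPolyOfSatake_one_injective ι _ heq
  -- reciprocity up to irreducibility (the text of crux stmt-Langlands-14328) for the `Rec` of LGC
  have hE : ∀ (F : Type) [Field F] [NumberField F], ∃ Rec : ReciprocityData F, ∀ n : ℕ, 0 < n →
      ∀ hcpt : isCompact_glFiniteIntegralLevel n F,
        (∀ π : CuspidalAutomorphicRepData n F hcpt, π.1.IsLAlgebraic →
          ∀ (ℓ : ℕ) [Fact ℓ.Prime] (ι : PadicAlgCl ℓ ≃+* ℂ),
            ∃ ρ : FramedGaloisRep F (PadicAlgCl ℓ) n, IsGeometricFramed Rec ρ ∧ Corresponds Rec ι π.1 ρ) ∧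
        GaloisToAutomorphic n Rec hcpt := by
    intro F _ _
    obtain ⟨Rec, hRec⟩ := hL F
    refine ⟨Rec, fun n hn hcpt => ⟨fun π hLalg ℓ _ ι => ?_, fun ℓ _ ι ρ hirr hgeo => ?_⟩⟩
    · obtain ⟨ρ, hgeo, hρ⟩ := hW F n hcpt hn π hLalg ℓ ι
      have hirr : ρ.toGaloisRep.IsIrreducible := irr F n hcpt hn π ℓ ι ρ hgeo hρ
      exact ⟨ρ, hgeo, hρ, hRec n hcpt hn π hLalg ℓ ι ρ hirr hgeo hρ⟩
    · obtain ⟨π, hLalg, hρ⟩ := hB F n hcpt hn ℓ ι ρ hirr hgeo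
      exact ⟨π, hLalg, hρ, hRec n hcpt hn π hLalg ℓ ι ρ hirr hgeo hρ⟩
  -- the summit: irreducibility of every avatar and Chebotarev–Brauer–Nesbitt uniqueness (landed, structural)
  exact Summit.Langlands.Langlands.Theorems.IrreducibleOffSector.langlands_of_reciprocityUpToIrreducibility_text_of_JS
    hJSb hJSp hE

/-- By-name sanity check (an `example`, not a declaration): the six stubs feed the composition as they stand. -/
example : SectorComplement :=
  SectorComplement_of stub_weakExistence stub_weakAutomorphyOffTateFrames stub_tateFramesOfTarget
    stub_pairCompatibility stub_pairLBoundaryJS stub_pairLPoleJS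

end Summit.Langlands.Langlands.Cruxes.SectorComplement.BirthFifteenLocusEisenstein

end
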